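import Mathlib
import HarnessLib
import Literature.Analysis.FluidPDE.AxisymHouLiVariables
import Summits.NavierStokesRegularity.NavierStokesRegularity.Theorems.PoloidalWindowDoorPoloidalWindowRigidityZShockSlopeFunctionConnected

/-!
# Crux K2 `PoloidalWindowRigidity` (stmt-NavierStokesRegularity-19708), line `z_shock` — the two exact NOETHER CONSERVATION LAWS of the
# autonomous height-evolution (energy and horizontal momentum in the height `z`), kernel-checked in the stubs' vocabulary

`--supports stmt-NavierStokesRegularity-19708 --as helper` (leafhand-ns-poloidalwindowdoor-3 g4, cell decomp-ns, 2026-08-31).  **No stub and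
no summit is closed by this file; Navier–Stokes regularity is NOT proved here (rung 0).**

WHY THIS FILE.  The card `Cruxes/PoloidalWindowRigidity/Lines/z_shock.md` (§Idea, «Height as time») rests the deciding stub
`stub_zShockThickAut` on reading each slice of an autonomous-column class profile as a trajectory of the canonical `z`-evolution of the pair
`(φ, w)` (`vₕ = ∇ₕφ`, `φ_z = Γ(w)`, `w_z = −Δₕφ`, Hamiltonian `∫[Ψ(w) − ½|∇ₕφ|²]`, `Ψ' = Γ`, `Γ' = G` the slope function), and names as
«the ONE global-in-height structure the (TH) column has not» its two EXACT LOCAL NOETHER LAWS — the only non-perturbative handles the card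
offers for rung R3 (two-sided eternal rigidity in `2+1` dimensions: «the energy–momentum Noether laws give monotone weighted fluxes along
acoustic cones»).  The 1-D shadow R2 is now exhausted in the tree (hands 1-g0 … 3-g3, ≈40 files); the R3 entrance so far consists of the slope
function (`…ZShockSlopeFunctionConnected`), the height-evolution equation (`…ZShockHeightEvolution`) and genuine nonlinearity
(`…ZShockGenuineNonlinearity`).  This file adds the conservation laws, as pointwise identities needing only FIRST derivatives of the slice:

* `energyLaw_of_slope` (class-free, pointwise): `f : ℝ³ → ℝ³` differentiable at `x`, slope law `∂₂f_b = G(f₂)·∂_b f₂` (`b = 0, 1`) AT `x`,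
  `div f (x) = 0`, and any `Γ, Ψ` with `Γ' = G`, `Ψ' = Γ` at the value `f₂(x)` ⇒
  `∂₂[Ψ(f₂) − ½(f₀² + f₁²)] + ∂₀[Γ(f₂) f₀] + ∂₁[Γ(f₂) f₁] = 0` at `x` (z-translation: energy density `Ψ(w) − ½|vₕ|²`, flux `Γ(w) vₕ`).
* `momentumLaw_zero_of_slope`, `momentumLaw_one_of_slope` (class-free, pointwise): with, in addition, poloidality `∂₀f₁ = ∂₁f₀` at `x` and
  any `Θ` with `Θ' (w) = w·G(w)` at the value ⇒
  `∂₂[f₂ f_i] + ∂₀[f_i f₀] + ∂₁[f_i f₁] − ∂_i[½(f₀² + f₁²) + Θ(f₂)] = 0` at `x`, `i = 0, 1` (horizontal translations: momentum density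
  `w v_i`, the card's `Θ_w = w G_w`; `Θ` is precisely the THICK-NF pressure potential).
* `noetherLaws_of_class_autonomy` (class entry): class binders of `stub_zShockThickAut` (Type-I rate, continuity on the slab, Oseen identity,
  divergence-free, poloidal) + the stub's LOCAL autonomy clause at `z₀ ∈ W₁` ⇒ on every open connected `Ω ⊆ {∇ₕv₂(t₀,·) ≠ 0}` of the slice
  `t₀ = z₀.1` there is ONE slope function `G`, real-analytic at the values, such that for EVERY choice of antiderivatives `Γ, Ψ, Θ`
  (`Γ' = G`, `Ψ' = Γ`, `Θ'(w) = w G(w)` at the values on `Ω` — the gauge is the user's) the three conservation laws hold at every point of `Ω`.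

Honest scope: bookkeeping for R3 (S-sized, exact, no estimate); the laws are kinematic (poloidal + divergence-free + slope law), NS enters
only through the class facts that produce the slope function; the positive-definite wave energy `½w_z² + ½c²(w)|∇ₕw|²` (`c² = −G`) is NOT
conserved on the thick column (its `z`-derivative carries the signed cubic source `−½G'(w) w_z|∇ₕw|²`, zero iff (TH)) — not formalised here.
presearch: «Noether conservation laws quasilinear wave equation height as time poloidal» → corpus/galaxy: nothing fluid-Liouville (card's
presearch); the identities are three-line hand computations (card §Idea). [folklore]
-/

noncomputable section

namespace Summit.NavierStokesRegularity.NavierStokesRegularity.Theorems.PoloidalWindowDoorPoloidalWindowRigidityZShockNoetherLaws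

-- the problem directory repeats the summit name (`NavierStokesRegularity/NavierStokesRegularity`)
set_option linter.dupNamespace false

open Set Filter Topology Function
open Literature.Analysis Literature.Analysis.FluidPDE
open Summit.NavierStokesRegularity.NavierStokesRegularity.Theorems.PoloidalWindowDoorPoloidalWindowRigidityZShockSlopeFunctionConnected

/-! ## Class-free pointwise identities -/

section ClassFree

variable {f : EuclideanSpace ℝ (Fin 3) → EuclideanSpace ℝ (Fin 3)} {x : EuclideanSpace ℝ (Fin 3)}

/-- Coordinate functions of a field differentiable at `x` have the expected Fréchet derivative. -/
theorem hasFDerivAt_coord (hf : DifferentiableAt ℝ f x) (i : Fin 3) :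
    HasFDerivAt (fun y => f y i) ((EuclideanSpace.proj (𝕜 := ℝ) i).comp (fderiv ℝ f x)) x :=
  (EuclideanSpace.proj (𝕜 := ℝ) i).hasFDerivAt.comp x hf.hasFDerivAt

/-- **Energy law (z-translation Noether law) of the autonomous height-evolution, pointwise.**  If `f` is differentiable at `x`, obeys the
slope law `∂₂f_b = G(f₂)·∂_b f₂` (`b = 0, 1`) at `x` and `div f (x) = 0`, then for any `Γ, Ψ` with `Γ' = G` and `Ψ' = Γ` at the value
`f₂(x)`: `∂₂[Ψ(f₂) − ½(f₀² + f₁²)] + ∂₀[Γ(f₂)·f₀] + ∂₁[Γ(f₂)·f₁] = 0` at `x`. [folklore] -/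
theorem energyLaw_of_slope (hf : DifferentiableAt ℝ f x) {G Γ Ψ : ℝ → ℝ}
    (hΓ : HasDerivAt Γ (G (f x 2)) (f x 2)) (hΨ : HasDerivAt Ψ (Γ (f x 2)) (f x 2))
    (hslope : ∀ b : Fin 3, b ≠ 2 →
      fderiv ℝ f x (EuclideanSpace.single 2 1) b = G (f x 2) * fderiv ℝ f x (EuclideanSpace.single b 1) 2)
    (hdiv : VectorCalculus.divergence f x = 0) :
    fderiv ℝ (fun y => Ψ (f y 2) - (1 / 2) * (f y 0 ^ 2 + f y 1 ^ 2)) x (EuclideanSpace.single 2 1) +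
      fderiv ℝ (fun y => Γ (f y 2) * f y 0) x (EuclideanSpace.single 0 1) +
      fderiv ℝ (fun y => Γ (f y 2) * f y 1) x (EuclideanSpace.single 1 1) = 0 := by
  set e0 : EuclideanSpace ℝ (Fin 3) := EuclideanSpace.single 0 1 with he0
  set e1 : EuclideanSpace ℝ (Fin 3) := EuclideanSpace.single 1 1 with he1
  set e2 : EuclideanSpace ℝ (Fin 3) := EuclideanSpace.single 2 1 with he2
  have hc := hasFDerivAt_coord hf
  -- the three derivatives
  have hE : HasFDerivAt (fun y => Ψ (f y 2) - (1 / 2) * (f y 0 ^ 2 + f y 1 ^ 2)) _ x :=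
    (hΨ.comp_hasFDerivAt x (hc 2)).sub ((((hc 0).pow 2).add ((hc 1).pow 2)).const_mul (1 / 2 : ℝ))
  have hF0 : HasFDerivAt (fun y => Γ (f y 2) * f y 0)
      (Γ (f x 2) • (EuclideanSpace.proj (𝕜 := ℝ) 0).comp (fderiv ℝ f x) +
        f x 0 • (G (f x 2) • (EuclideanSpace.proj (𝕜 := ℝ) 2).comp (fderiv ℝ f x))) x :=
    (hΓ.comp_hasFDerivAt x (hc 2)).mul (hc 0)
  have hF1 : HasFDerivAt (fun y => Γ (f y 2) * f y 1)
      (Γ (f x 2) • (EuclideanSpace.proj (𝕜 := ℝ) 1).comp (fderiv ℝ f x) +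
        f x 1 • (G (f x 2) • (EuclideanSpace.proj (𝕜 := ℝ) 2).comp (fderiv ℝ f x))) x :=
    (hΓ.comp_hasFDerivAt x (hc 2)).mul (hc 1)
  rw [hE.fderiv, hF0.fderiv, hF1.fderiv]
  simp only [_root_.sub_apply, _root_.add_apply, _root_.smul_apply, ContinuousLinearMap.comp_apply, smul_eq_mul, nsmul_eq_mul]
  have hp : ∀ (i : Fin 3) (u : EuclideanSpace ℝ (Fin 3)), (EuclideanSpace.proj (𝕜 := ℝ) i) (fderiv ℝ f x u) = fderiv ℝ f x u i :=
    fun i u => rfl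
  simp only [hp]
  have hd : fderiv ℝ f x e0 0 + fderiv ℝ f x e1 1 + fderiv ℝ f x e2 2 = 0 := by
    rw [← divergence_eq_sum_three]; exact hdiv
  have h0 := hslope 0 (by decide)
  have h1 := hslope 1 (by decide)
  simp only [← he0, ← he1] at h0 h1
  simp only [Nat.cast_ofNat, pow_one, Nat.add_one_sub_one]
  linear_combination Γ (f x 2) * hd - f x 0 * h0 - f x 1 * h1

/-- The third curl component in coordinates: `(curl f x)₂ = ∂₀f₁ − ∂₁f₀` (so poloidality `(curl f)₂ = 0` is `∂₀f₁ = ∂₁f₀`). [folklore] -/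
theorem fderiv_zero_one_eq_of_curl_two (h : curl f x 2 = 0) :
    fderiv ℝ f x (EuclideanSpace.single 0 1) 1 = fderiv ℝ f x (EuclideanSpace.single 1 1) 0 := by
  have e : curl f x 2 = fderiv ℝ f x (EuclideanSpace.single 0 1) 1 - fderiv ℝ f x (EuclideanSpace.single 1 1) 0 := by
    simp [curl]
  rw [e] at h
  linarith

/-- **First horizontal momentum law (x₀-translation Noether law), pointwise.**  If `f` is differentiable at `x`, poloidal at `x`
(`(curl f)₂ = 0`), divergence-free at `x`, and obeys the slope law for the component `b = 0` at `x`, then for any `Θ` with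
`Θ'(w) = w·G(w)` at the value `w = f₂(x)`:
`∂₂[f₂ f₀] + ∂₀[f₀ f₀] + ∂₁[f₀ f₁] − ∂₀[½(f₀² + f₁²) + Θ(f₂)] = 0` at `x`. [folklore] -/
theorem momentumLaw_zero_of_slope (hf : DifferentiableAt ℝ f x) {G Θ : ℝ → ℝ}
    (hΘ : HasDerivAt Θ (f x 2 * G (f x 2)) (f x 2))
    (hslope : fderiv ℝ f x (EuclideanSpace.single 2 1) 0 = G (f x 2) * fderiv ℝ f x (EuclideanSpace.single 0 1) 2)
    (hdiv : VectorCalculus.divergence f x = 0) (hpol : curl f x 2 = 0) :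
    fderiv ℝ (fun y => f y 2 * f y 0) x (EuclideanSpace.single 2 1) +
      fderiv ℝ (fun y => f y 0 * f y 0) x (EuclideanSpace.single 0 1) +
      fderiv ℝ (fun y => f y 0 * f y 1) x (EuclideanSpace.single 1 1) -
      fderiv ℝ (fun y => (1 / 2) * (f y 0 ^ 2 + f y 1 ^ 2) + Θ (f y 2)) x (EuclideanSpace.single 0 1) = 0 := by
  set e0 : EuclideanSpace ℝ (Fin 3) := EuclideanSpace.single 0 1 with he0
  set e1 : EuclideanSpace ℝ (Fin 3) := EuclideanSpace.single 1 1 with he1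
  set e2 : EuclideanSpace ℝ (Fin 3) := EuclideanSpace.single 2 1 with he2
  have hc := hasFDerivAt_coord hf
  have hA : HasFDerivAt (fun y => f y 2 * f y 0) _ x := (hc 2).mul (hc 0)
  have hB : HasFDerivAt (fun y => f y 0 * f y 0) _ x := (hc 0).mul (hc 0)
  have hC : HasFDerivAt (fun y => f y 0 * f y 1) _ x := (hc 0).mul (hc 1)
  have hD : HasFDerivAt (fun y => (1 / 2) * (f y 0 ^ 2 + f y 1 ^ 2) + Θ (f y 2)) _ x :=
    ((((hc 0).pow 2).add ((hc 1).pow 2)).const_mul (1 / 2 : ℝ)).add (hΘ.comp_hasFDerivAt x (hc 2))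
  rw [hA.fderiv, hB.fderiv, hC.fderiv, hD.fderiv]
  simp only [_root_.add_apply, _root_.smul_apply, ContinuousLinearMap.comp_apply, smul_eq_mul, nsmul_eq_mul]
  have hp : ∀ (i : Fin 3) (u : EuclideanSpace ℝ (Fin 3)), (EuclideanSpace.proj (𝕜 := ℝ) i) (fderiv ℝ f x u) = fderiv ℝ f x u i :=
    fun i u => rfl
  simp only [hp]
  have hd : fderiv ℝ f x e0 0 + fderiv ℝ f x e1 1 + fderiv ℝ f x e2 2 = 0 := by
    rw [← divergence_eq_sum_three]; exact hdiv
  have hq := fderiv_zero_one_eq_of_curl_two hpol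
  simp only [← he0, ← he1] at hq hslope
  simp only [Nat.cast_ofNat, pow_one, Nat.add_one_sub_one]
  linear_combination f x 0 * hd + f x 2 * hslope - f x 1 * hq

/-- **Second horizontal momentum law (x₁-translation Noether law), pointwise.**  As `momentumLaw_zero_of_slope` with the roles of the
two horizontal directions exchanged: `∂₂[f₂ f₁] + ∂₀[f₁ f₀] + ∂₁[f₁ f₁] − ∂₁[½(f₀² + f₁²) + Θ(f₂)] = 0` at `x`. [folklore] -/
theorem momentumLaw_one_of_slope (hf : DifferentiableAt ℝ f x) {G Θ : ℝ → ℝ}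
    (hΘ : HasDerivAt Θ (f x 2 * G (f x 2)) (f x 2))
    (hslope : fderiv ℝ f x (EuclideanSpace.single 2 1) 1 = G (f x 2) * fderiv ℝ f x (EuclideanSpace.single 1 1) 2)
    (hdiv : VectorCalculus.divergence f x = 0) (hpol : curl f x 2 = 0) :
    fderiv ℝ (fun y => f y 2 * f y 1) x (EuclideanSpace.single 2 1) +
      fderiv ℝ (fun y => f y 1 * f y 0) x (EuclideanSpace.single 0 1) +
      fderiv ℝ (fun y => f y 1 * f y 1) x (EuclideanSpace.single 1 1) -
      fderiv ℝ (fun y => (1 / 2) * (f y 0 ^ 2 + f y 1 ^ 2) + Θ (f y 2)) x (EuclideanSpace.single 1 1) = 0 := by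
  set e0 : EuclideanSpace ℝ (Fin 3) := EuclideanSpace.single 0 1 with he0
  set e1 : EuclideanSpace ℝ (Fin 3) := EuclideanSpace.single 1 1 with he1
  set e2 : EuclideanSpace ℝ (Fin 3) := EuclideanSpace.single 2 1 with he2
  have hc := hasFDerivAt_coord hf
  have hA : HasFDerivAt (fun y => f y 2 * f y 1) _ x := (hc 2).mul (hc 1)
  have hB : HasFDerivAt (fun y => f y 1 * f y 0) _ x := (hc 1).mul (hc 0)
  have hC : HasFDerivAt (fun y => f y 1 * f y 1) _ x := (hc 1).mul (hc 1)
  have hD : HasFDerivAt (fun y => (1 / 2) * (f y 0 ^ 2 + f y 1 ^ 2) + Θ (f y 2)) _ x :=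
    ((((hc 0).pow 2).add ((hc 1).pow 2)).const_mul (1 / 2 : ℝ)).add (hΘ.comp_hasFDerivAt x (hc 2))
  rw [hA.fderiv, hB.fderiv, hC.fderiv, hD.fderiv]
  simp only [_root_.add_apply, _root_.smul_apply, ContinuousLinearMap.comp_apply, smul_eq_mul, nsmul_eq_mul]
  have hp : ∀ (i : Fin 3) (u : EuclideanSpace ℝ (Fin 3)), (EuclideanSpace.proj (𝕜 := ℝ) i) (fderiv ℝ f x u) = fderiv ℝ f x u i :=
    fun i u => rfl
  simp only [hp]
  have hd : fderiv ℝ f x e0 0 + fderiv ℝ f x e1 1 + fderiv ℝ f x e2 2 = 0 := by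
    rw [← divergence_eq_sum_three]; exact hdiv
  have hq := fderiv_zero_one_eq_of_curl_two hpol
  simp only [← he0, ← he1] at hq hslope
  simp only [Nat.cast_ofNat, pow_one, Nat.add_one_sub_one]
  linear_combination f x 1 * hd + f x 2 * hslope + f x 0 * hq

end ClassFree

/-! ## Class entry: the conservation laws on every connected non-degenerate region of a slice of an autonomous-column class profile -/

/-- **The Noether laws for the route's class.**  Class binders of `stub_zShockThickAut` (Type-I rate, continuity on the slab, unit-viscosity
Oseen identity, divergence-free, poloidal) + the stub's LOCAL autonomy clause at `z₀ ∈ W₁`: on every open connected `Ω ⊆ {∇ₕv₂(t₀,·) ≠ 0}` of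
the slice `t₀ = z₀.1` there is ONE slope function `G`, real-analytic at the values `v₂(t₀,x)` (`x ∈ Ω`), with the slope law on `Ω`, such that
for EVERY choice of `Γ, Ψ, Θ : ℝ → ℝ` with `Γ' = G`, `Ψ' = Γ`, `Θ'(w) = w·G(w)` at the values on `Ω`, at every `x ∈ Ω` the energy law
`∂₂[Ψ(v₂) − ½|vₕ|²] + divₕ(Γ(v₂) vₕ) = 0` and the two momentum laws `∂₂[v₂ v_i] + ∂ⱼ[v_i v_j] − ∂_i[½|vₕ|² + Θ(v₂)] = 0` (`i = 0, 1`) hold.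
[folklore] -/
theorem noetherLaws_of_class_autonomy (C : ℝ) (v : ℝ → EuclideanSpace ℝ (Fin 3) → EuclideanSpace ℝ (Fin 3))
    (hrate : Literature.Analysis.FluidPDE.HasTypeITimeDecay C v)
    (hcont : ContinuousOn (Function.uncurry v) (Set.Iio (0 : ℝ) ×ˢ Set.univ))
    (hmild : ∀ s t : ℝ, s < t → t < 0 → ∀ x, v t x =
      Literature.Analysis.UnboundedOperators.heatExtension (v s) (t - s) x -
        Literature.Analysis.FluidPDE.oseenDuhamel 1 s v v t x)
    (hdiv : ∀ t < 0, Literature.Analysis.FluidPDE.VectorCalculus.IsDivFree (v t))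
    (hpol : ∀ s < 0, ∀ y, inner ℝ (Literature.Analysis.FluidPDE.curl (v s) y) (EuclideanSpace.single 2 1) = 0)
    {W₁ : Set (ℝ × EuclideanSpace ℝ (Fin 3))} (hW₁ : IsOpen W₁) (hW₁s : W₁ ⊆ Set.Iio (0 : ℝ) ×ˢ Set.univ)
    {z₀ : ℝ × EuclideanSpace ℝ (Fin 3)} (hz₀ : z₀ ∈ W₁) {g : ℝ → ℝ → ℝ}
    (haut : ∀ z ∈ W₁, ∀ b : Fin 3, b ≠ 2 →
      fderiv ℝ (v z.1) z.2 (EuclideanSpace.single 2 1) b =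
        g z.1 (v z.1 z.2 2) * fderiv ℝ (v z.1) z.2 (EuclideanSpace.single b 1) 2)
    {Ω : Set (EuclideanSpace ℝ (Fin 3))} (hΩ : IsPreconnected Ω) (hΩo : IsOpen Ω)
    (hΩnd : ∀ x ∈ Ω, fderiv ℝ (v z₀.1) x (EuclideanSpace.single 0 1) 2 ≠ 0 ∨
      fderiv ℝ (v z₀.1) x (EuclideanSpace.single 1 1) 2 ≠ 0) :
    ∃ G : ℝ → ℝ, (∀ x ∈ Ω, AnalyticAt ℝ G (v z₀.1 x 2)) ∧
      (∀ x ∈ Ω, ∀ b : Fin 3, b ≠ 2 → fderiv ℝ (v z₀.1) x (EuclideanSpace.single 2 1) b =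
        G (v z₀.1 x 2) * fderiv ℝ (v z₀.1) x (EuclideanSpace.single b 1) 2) ∧
      ∀ Γ Ψ Θ : ℝ → ℝ,
        (∀ x ∈ Ω, HasDerivAt Γ (G (v z₀.1 x 2)) (v z₀.1 x 2)) →
        (∀ x ∈ Ω, HasDerivAt Ψ (Γ (v z₀.1 x 2)) (v z₀.1 x 2)) →
        (∀ x ∈ Ω, HasDerivAt Θ (v z₀.1 x 2 * G (v z₀.1 x 2)) (v z₀.1 x 2)) →
        ∀ x ∈ Ω,
          (fderiv ℝ (fun y => Ψ (v z₀.1 y 2) - (1 / 2) * (v z₀.1 y 0 ^ 2 + v z₀.1 y 1 ^ 2)) x (EuclideanSpace.single 2 1) +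
              fderiv ℝ (fun y => Γ (v z₀.1 y 2) * v z₀.1 y 0) x (EuclideanSpace.single 0 1) +
              fderiv ℝ (fun y => Γ (v z₀.1 y 2) * v z₀.1 y 1) x (EuclideanSpace.single 1 1) = 0) ∧
          (fderiv ℝ (fun y => v z₀.1 y 2 * v z₀.1 y 0) x (EuclideanSpace.single 2 1) +
              fderiv ℝ (fun y => v z₀.1 y 0 * v z₀.1 y 0) x (EuclideanSpace.single 0 1) +
              fderiv ℝ (fun y => v z₀.1 y 0 * v z₀.1 y 1) x (EuclideanSpace.single 1 1) -
              fderiv ℝ (fun y => (1 / 2) * (v z₀.1 y 0 ^ 2 + v z₀.1 y 1 ^ 2) + Θ (v z₀.1 y 2)) x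
                (EuclideanSpace.single 0 1) = 0) ∧
          (fderiv ℝ (fun y => v z₀.1 y 2 * v z₀.1 y 1) x (EuclideanSpace.single 2 1) +
              fderiv ℝ (fun y => v z₀.1 y 1 * v z₀.1 y 0) x (EuclideanSpace.single 0 1) +
              fderiv ℝ (fun y => v z₀.1 y 1 * v z₀.1 y 1) x (EuclideanSpace.single 1 1) -
              fderiv ℝ (fun y => (1 / 2) * (v z₀.1 y 0 ^ 2 + v z₀.1 y 1 ^ 2) + Θ (v z₀.1 y 2)) x
                (EuclideanSpace.single 1 1) = 0) := by
  obtain ⟨G, hGA, hG⟩ := autonomy_on_connected_of_class_autonomy C v hrate hcont hmild hdiv hpol hW₁ hW₁s hz₀ haut hΩ hΩo hΩnd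
  have ht₀ : z₀.1 < 0 := (Set.mem_prod.1 (hW₁s hz₀)).1
  have hbdd : ∀ δ : ℝ, 0 < δ → ∃ B : ℝ, ∀ t < -δ, ∀ y : EuclideanSpace ℝ (Fin 3), ‖v t y‖ ≤ B := by
    intro δ hδ
    refine ⟨|C| / Real.sqrt δ, fun t ht y => ?_⟩
    have hδt : δ ≤ -t := by linarith
    have hsq : Real.sqrt δ ≤ Real.sqrt (-t) := Real.sqrt_le_sqrt hδt
    have hsqpos : 0 < Real.sqrt δ := Real.sqrt_pos.2 hδ
    calc ‖v t y‖ ≤ C / Real.sqrt (-t) := hrate t (by linarith) y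
      _ ≤ |C| / Real.sqrt (-t) := by gcongr; exact le_abs_self C
      _ ≤ |C| / Real.sqrt δ := by gcongr
  have han : AnalyticOnNhd ℝ (v z₀.1) univ :=
    Literature.Analysis.NavierStokesZoomKit.LocalSineTubeDoorProfileAlignedWindowRigidityAncient.analyticOnNhd_slice
      hcont hbdd hmild ht₀
  have hdf : ∀ y, DifferentiableAt ℝ (v z₀.1) y := fun y => (han y (mem_univ _)).differentiableAt
  have hdiv0 : ∀ y, VectorCalculus.divergence (v z₀.1) y = 0 := fun y => hdiv z₀.1 ht₀ y
  have hpol0 : ∀ y, curl (v z₀.1) y 2 = 0 := fun y => by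
    simpa [EuclideanSpace.inner_single_right] using hpol z₀.1 ht₀ y
  refine ⟨G, hGA, hG, fun Γ Ψ Θ hΓ hΨ hΘ x hx => ⟨?_, ?_, ?_⟩⟩
  · exact energyLaw_of_slope (hdf x) (hΓ x hx) (hΨ x hx) (hG x hx) (hdiv0 x)
  · exact momentumLaw_zero_of_slope (hdf x) (hΘ x hx) (hG x hx 0 (by decide)) (hdiv0 x) (hpol0 x)
  · exact momentumLaw_one_of_slope (hdf x) (hΘ x hx) (hG x hx 1 (by decide)) (hdiv0 x) (hpol0 x)

end Summit.NavierStokesRegularity.NavierStokesRegularity.Theorems.PoloidalWindowDoorPoloidalWindowRigidityZShockNoetherLaws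

end
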